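import Literature.InformationTheory.QuantumCodes.LinkedCluster
import Literature.Probability.LatticeModels.LatticeAnimalsGraph
import Mathlib.Algebra.CharP.Two
import Mathlib.Data.ZMod.Basic
import HarnessLib

/-!
# Failure of minimum-weight decoding forces a dense connected cluster (Kovalev–Pryadko 2013, Gottesman 2014)

Topic `Literature/InformationTheory/QuantumCodes`. Theorem-only file (definitions with bodies + proved theorems;
no named fact, no sorry). Companion of `LinkedCluster.lean` (minimum-weight CODEWORDS have linked support — the
distance-certificate side) and of `ClusterCountingBound.lean` (the union bound over dense connected clusters — the
probabilistic side); this file is the DECODING side that connects them.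

This is the coding half of the counting-argument threshold theorem for low-density parity-check codes
(Kovalev–Pryadko 2013 Thm. 3; Gottesman 2014 Thm. 3), in the generality of one error TYPE of a CSS code — a
binary check matrix `H : Matrix (Fin m) (Fin n) (ZMod 2)` (say the `Z`-checks, detecting `X`-errors
`e : Fin n → ZMod 2`) together with an arbitrary `𝔽₂`-subspace `SX` of "trivial" errors (the row space of the
`X`-checks, `rowSpaceOf HX` of `LinkedCluster.lean`; for a classical code `SX = ⊥`). Decoding the syndrome `H e` by
ANY minimum-weight rule returns `e'` with `H e' = H e` and `‖e'‖ ≤ ‖x‖` for every `x` with `H x = H e`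
(`‖·‖ = hammingNorm`); it FAILS when `e + e' ∉ SX`.

* `supp x` — the support of a binary vector as a `Finset` (`#(supp x) = hammingNorm x`).
* `checkGraph H` — the adjacency graph of the checks on the (qu)bits: `u ~ v` iff `u ≠ v` and some row of `H` is
  non-zero at both (Gottesman 2014 §4 "adjacency graph of the code"; Kovalev–Pryadko 2013 / Kovalev–Dumer–Pryadko
  2013: the graph `𝒢₁`, kept implicit in `LinkedCluster.lean`). `degree_checkGraph_le`: if every row of `H` has at
  most `w` non-zero entries and every column at most `c`, all degrees are `≤ c (w - 1)` (the printed `z = (r-1)c`).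
* `exists_connected_piece` — if `H D = 0` and `D ∉ SX`, some `checkGraph H`-connected `A ⊆ supp D`
  (cut-connectedness `IsGraphConnected` of `Literature.Probability.LatticeModels.LatticeAnimalsGraph`) has
  `H (D|_A) = 0` and `D|_A ∉ SX` (split the support along a cut with no check across it — both halves keep zero
  syndrome by `mulVec_restrictTo_eq_zero` of `LinkedCluster.lean` — keep a half outside `SX`, induct).
* `card_le_two_mul_card_inter_of_minWeight` — if `e'` is a minimum-weight solution of `H e' = H e` and
  `A ⊆ supp (e + e')` carries a zero-syndrome restriction of `e + e'`, then `|A| ≤ 2 |A ∩ supp e|` (flip `e'` on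
  `A`; Dennis–Kitaev–Landahl–Preskill 2002 §5.2 eq. (e_m_ineq2) is the same step for chains).
* **`exists_denseCluster_of_minWeight_failure`** — if `d ≤ ‖x‖` for every `x ∈ ker H ∖ SX` (so `d ≤ d_X`) and
  minimum-weight decoding of `e` fails, there is a `checkGraph H`-connected `S` with `d ≤ |S| ≤ 2 |S ∩ supp e|`,
  i.e. the event `HasDenseCluster (checkGraph H) d (supp e)` of `ClusterCountingBound.lean`. Printed form
  (Gottesman 2014, proof of Thm. 3): "if this decoding procedure results in a logical error, then there must be
  some connected cluster of `s ≥ d_i` qubits such that the cluster contains `m ≥ ⌈s/2⌉` errors".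

Combined with `sum_hasDenseCluster_le_geometric` (`ClusterCountingBound.lean`) this gives, for any minimum-weight
decoder and any locally stochastic `X`-noise of parameter `p` with `r = 2Δ²√p < 1`, `Δ ≥ c(w-1)`:
`P(failure) ≤ n r^d / (Δ²(1-r))` — Kovalev–Pryadko's / Gottesman's threshold `p₀ = (2Δ²)⁻²` for one error type of
an LDPC CSS family with `d → ∞`; that assembly is left to the consumer (`Summits/Ventures/QEC/Thresholds`), which
owns the decoder and noise-model vocabulary. Deliberately NOT here: general (non-CSS) stabilizer codes with
depolarizing noise (Gottesman's Thm. 3 is printed for those; the same proof goes through with Pauli-valued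
vectors), syndrome-measurement errors (Gottesman Thm. 4, Dumer–Kovalev–Pryadko 2015 Thm. 3), probabilities.

## References

* [KovalevPryadko2013] A. A. Kovalev, L. P. Pryadko, Phys. Rev. A 87 (2013) 020304(R), arXiv:1208.2317 — Thm. 3 and
  its proof ("violating `(s,m)`-sets"); §II ("different clusters affect disjoint sets of stabilizer generators").
* [Gottesman2014] D. Gottesman, Quantum Inf. Comput. 14 (2014) 1338, arXiv:1310.2984 — §4: Def. 1, the adjacency
  graph and its degree `z = (r-1)c`, Thm. 3 (proof, first claim).
* [DennisEtAl2002] E. Dennis, A. Kitaev, A. Landahl, J. Preskill, J. Math. Phys. 43 (2002) 4452 — §5.2.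
* [KovalevDumerPryadko2013] for `restrictTo` / `mulVec_restrictTo_eq_zero` via `LinkedCluster.lean`.
-/

open Finset Matrix

namespace Literature.InformationTheory.QuantumCodes

open Literature.Probability.LatticeModels

/-! ### Supports and the check graph (any index types) -/

section Graph

variable {ι V : Type*} [Fintype V] [DecidableEq V]

/-- The support of a binary vector, as a `Finset`; its cardinality is the Hamming weight `hammingNorm`
(Nielsen–Chuang §10.5.5: the weight of an error is the number of non-identity tensor factors).
[cite: Gottesman2014, Def 1 (weight of a Pauli / support)] -/
def supp (x : V → ZMod 2) : Finset V := univ.filter fun v => x v ≠ 0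

omit [DecidableEq V] in
/-- Membership in the support. [folklore] -/
private theorem mem_supp {x : V → ZMod 2} {v : V} : v ∈ supp x ↔ x v ≠ 0 := by
  simp [supp]

omit [DecidableEq V] in
/-- The cardinality of the support is the Hamming weight. [folklore] -/
private theorem card_supp (x : V → ZMod 2) : (supp x).card = hammingNorm x := rfl

/-- The **adjacency (connectivity) graph** of a check matrix `H` on the set `V` of (qu)bits: `u ~ v` iff `u ≠ v` and
some check (row of `H`) acts on both. (Gottesman 2014 §4: "one node for each qubit …, two nodes are connected by an
edge iff there is an element of the stabilizer [generating set] acting non-trivially on both"; Kovalev–Dumer–Pryadko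
2013 §4: the graph `G₁`.) [cite: Gottesman2014, §4 (adjacency graph of the code)] -/
def checkGraph (H : Matrix ι V (ZMod 2)) : SimpleGraph V where
  Adj u v := u ≠ v ∧ ∃ i, H i u ≠ 0 ∧ H i v ≠ 0
  symm := ⟨fun _ _ h => ⟨h.1.symm, h.2.imp fun _ hi => ⟨hi.2, hi.1⟩⟩⟩
  loopless := ⟨fun _ h => h.1 rfl⟩

/-- **Degree of the adjacency graph of an LDPC matrix.** If every row of `H` has at most `w` non-zero entries and
every column at most `c`, then every vertex of `checkGraph H` has degree `≤ c (w - 1)` (Gottesman 2014 §4: "for an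
`(r,c)`-LDPC code, this graph has bounded degree, with degree at most `z = (r-1)c`"; Kovalev–Pryadko 2013:
`z = (ℓ-1)j`). [cite: Gottesman2014, §4 (degree bound z = (r-1)c)] -/
theorem degree_checkGraph_le [Fintype ι] (H : Matrix ι V (ZMod 2)) [DecidableRel (checkGraph H).Adj] {w c : ℕ}
    (hrow : ∀ i, (univ.filter fun v => H i v ≠ 0).card ≤ w)
    (hcol : ∀ v, (univ.filter fun i => H i v ≠ 0).card ≤ c) (v : V) :
    (checkGraph H).degree v ≤ c * (w - 1) := by
  classical
  rw [← SimpleGraph.card_neighborFinset_eq_degree]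
  have hsub : (checkGraph H).neighborFinset v ⊆
      (univ.filter fun i => H i v ≠ 0).biUnion fun i => (univ.filter fun u => H i u ≠ 0).erase v := by
    intro u hu
    rw [SimpleGraph.mem_neighborFinset] at hu
    obtain ⟨hne, i, hiv, hiu⟩ := hu
    rw [Finset.mem_biUnion]
    exact ⟨i, Finset.mem_filter.2 ⟨Finset.mem_univ _, hiv⟩,
      Finset.mem_erase.2 ⟨hne.symm, Finset.mem_filter.2 ⟨Finset.mem_univ _, hiu⟩⟩⟩
  refine (Finset.card_le_card hsub).trans (Finset.card_biUnion_le.trans ?_)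
  have hterm : ∀ i ∈ (univ.filter fun i => H i v ≠ 0),
      ((univ.filter fun u => H i u ≠ 0).erase v).card ≤ w - 1 := by
    intro i hi
    rw [Finset.mem_filter] at hi
    have hv : v ∈ (univ.filter fun u => H i u ≠ 0) := Finset.mem_filter.2 ⟨Finset.mem_univ _, hi.2⟩
    rw [Finset.card_erase_of_mem hv]
    exact Nat.sub_le_sub_right (hrow i) 1
  refine (Finset.sum_le_sum hterm).trans ?_
  rw [Finset.sum_const, smul_eq_mul]
  exact Nat.mul_le_mul_right _ (hcol v)

end Graph

/-! ### Restrictions (API of `LinkedCluster.lean`) and their supports -/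

section Decoding

variable {m n : ℕ}

/-- The support of `v|_A` for `A ⊆ supp v` is `A`. [folklore] -/
private theorem supp_restrictTo_of_subset {v : Fin n → ZMod 2} {A : Finset (Fin n)} (hA : A ⊆ supp v) :
    supp (restrictTo A v) = A := by
  ext i
  rw [mem_supp]
  by_cases hi : i ∈ A
  · rw [restrictTo_apply_of_mem hi]
    exact ⟨fun _ => hi, fun _ => mem_supp.1 (hA hi)⟩
  · rw [restrictTo_apply_of_not_mem hi]
    exact ⟨fun h => (h rfl).elim, fun h => (hi h).elim⟩

/-- The support of `v|_{Aᶜ}` is `supp v ∖ A`. [folklore] -/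
private theorem supp_restrictTo_compl (v : Fin n → ZMod 2) (A : Finset (Fin n)) :
    supp (restrictTo Aᶜ v) = supp v \ A := by
  ext i
  rw [mem_supp, Finset.mem_sdiff, mem_supp]
  by_cases hi : i ∈ A
  · have : i ∉ Aᶜ := fun h => Finset.mem_compl.1 h hi
    rw [restrictTo_apply_of_not_mem this]
    exact ⟨fun h => (h rfl).elim, fun h => (h.2 hi).elim⟩
  · rw [restrictTo_apply_of_mem (Finset.mem_compl.2 hi)]
    exact ⟨fun h => ⟨h, hi⟩, fun h => h.1⟩

/-- Restricting twice along `A ⊆ B` is restricting to `A`. [folklore] -/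
private theorem restrictTo_restrictTo_of_subset (v : Fin n → ZMod 2) {A B : Finset (Fin n)} (hAB : A ⊆ B) :
    restrictTo A (restrictTo B v) = restrictTo A v := by
  funext i
  by_cases hi : i ∈ A
  · rw [restrictTo_apply_of_mem hi, restrictTo_apply_of_mem hi, restrictTo_apply_of_mem (hAB hi)]
  · rw [restrictTo_apply_of_not_mem hi, restrictTo_apply_of_not_mem hi]

/-- Restricting to the support changes nothing. [folklore] -/
private theorem restrictTo_supp_self (v : Fin n → ZMod 2) : restrictTo (supp v) v = v := by
  funext i
  by_cases hi : i ∈ supp v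
  · rw [restrictTo_apply_of_mem hi]
  · rw [restrictTo_apply_of_not_mem hi]
    rw [mem_supp, not_not] at hi
    exact hi.symm

/-- A cut of `supp D` in the check graph, in the "no row crosses" form consumed by
`mulVec_restrictTo_eq_zero`. [folklore] -/
private theorem rows_do_not_cross_of_cut (H : Matrix (Fin m) (Fin n) (ZMod 2)) {D : Fin n → ZMod 2}
    {A : Finset (Fin n)} (hcut : ∀ a ∈ A, ∀ b ∈ supp D \ A, ¬ (checkGraph H).Adj a b) :
    ∀ r i j, i ∈ A → j ∉ A → D i ≠ 0 → D j ≠ 0 → H r i ≠ 0 → H r j = 0 := by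
  intro r i j hi hj _ hDj hHi
  by_contra hHj
  have hne : i ≠ j := fun h => hj (h ▸ hi)
  exact hcut i hi j (Finset.mem_sdiff.2 ⟨mem_supp.2 hDj, hj⟩) ⟨hne, r, hHi, hHj⟩

/-- The same cut seen from the complementary side. [folklore] -/
private theorem rows_do_not_cross_compl_of_cut (H : Matrix (Fin m) (Fin n) (ZMod 2)) {D : Fin n → ZMod 2}
    {A : Finset (Fin n)} (hcut : ∀ a ∈ A, ∀ b ∈ supp D \ A, ¬ (checkGraph H).Adj a b) :
    ∀ r i j, i ∈ Aᶜ → j ∉ Aᶜ → D i ≠ 0 → D j ≠ 0 → H r i ≠ 0 → H r j = 0 := by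
  intro r i j hi hj hDi _ hHi
  rw [Finset.mem_compl] at hi
  rw [Finset.mem_compl, not_not] at hj
  by_contra hHj
  have hne : j ≠ i := fun h => hi (h ▸ hj)
  exact hcut j hj i (Finset.mem_sdiff.2 ⟨mem_supp.2 hDi, hi⟩) ⟨hne, r, hHj, hHi⟩

/-! ### A connected non-trivial zero-syndrome piece -/

/-- **Connected non-trivial piece.** If `D` has zero syndrome and is not in the trivial subspace `SX`, then some
`checkGraph H`-connected, non-empty `A ⊆ supp D` carries a zero-syndrome vector (the restriction `D|_A`) that is
still not in `SX`. (Split `supp D` along a cut with no check across it; both halves have zero syndrome —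
`mulVec_restrictTo_eq_zero`, Kovalev–Pryadko 2013 §II "different clusters affect disjoint sets of stabilizer
generators" — and one of them is non-trivial since `SX` is a subspace; induct on the support.) Gottesman 2014,
proof of Thm. 3: "There must be some such cluster `S` such that `G|_S` is not an element of the stabilizer —
otherwise `G` itself would be in the stabilizer". [cite: Gottesman2014, Thm 3 (proof)] -/
theorem exists_connected_piece (H : Matrix (Fin m) (Fin n) (ZMod 2)) (SX : Submodule (ZMod 2) (Fin n → ZMod 2))
    {D : Fin n → ZMod 2} (hD : H *ᵥ D = 0) (hDS : D ∉ SX) :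
    ∃ A : Finset (Fin n), A ⊆ supp D ∧ A.Nonempty ∧ IsGraphConnected (checkGraph H) A ∧
      H *ᵥ restrictTo A D = 0 ∧ restrictTo A D ∉ SX := by
  classical
  -- strong induction on the size of the support
  suffices hmain : ∀ k : ℕ, ∀ D : Fin n → ZMod 2, (supp D).card = k → H *ᵥ D = 0 → D ∉ SX →
      ∃ A : Finset (Fin n), A ⊆ supp D ∧ A.Nonempty ∧ IsGraphConnected (checkGraph H) A ∧
        H *ᵥ restrictTo A D = 0 ∧ restrictTo A D ∉ SX from hmain _ D rfl hD hDS
  intro k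
  induction k using Nat.strong_induction_on with
  | _ k ih =>
    intro D hk hD hDS
    have hne : (supp D).Nonempty := by
      rw [Finset.nonempty_iff_ne_empty]
      intro h
      apply hDS
      have : D = 0 := by
        funext i
        have hi : i ∉ supp D := by rw [h]; exact Finset.notMem_empty i
        rw [mem_supp, not_not] at hi
        exact hi
      rw [this]
      exact SX.zero_mem
    by_cases hconn : IsGraphConnected (checkGraph H) (supp D)
    · exact ⟨supp D, Finset.Subset.refl _, hne, hconn, by rw [restrictTo_supp_self]; exact hD,
        by rw [restrictTo_supp_self]; exact hDS⟩
    · -- a cut of `supp D` with no check across it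
      unfold IsGraphConnected at hconn
      push Not at hconn
      obtain ⟨A, hAsub, hAne, hBne, hcut⟩ := hconn
      -- both halves have zero syndrome
      have hDA : H *ᵥ restrictTo A D = 0 := mulVec_restrictTo_eq_zero H hD (rows_do_not_cross_of_cut H hcut)
      have hDB : H *ᵥ restrictTo Aᶜ D = 0 :=
        mulVec_restrictTo_eq_zero H hD (rows_do_not_cross_compl_of_cut H hcut)
      -- one half is non-trivial
      have hsplit : restrictTo A D ∉ SX ∨ restrictTo Aᶜ D ∉ SX := by
        by_contra h
        push Not at h
        exact hDS (restrictTo_add_restrictTo_compl A D ▸ SX.add_mem h.1 h.2)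
      -- sizes drop
      have hsuppA : supp (restrictTo A D) = A := supp_restrictTo_of_subset hAsub
      have hsuppB : supp (restrictTo Aᶜ D) = supp D \ A := supp_restrictTo_compl D A
      have hcardA : (supp (restrictTo A D)).card < k := by
        rw [hsuppA, ← hk]
        refine Finset.card_lt_card ⟨hAsub, fun h => ?_⟩
        obtain ⟨b, hb⟩ := hBne
        exact (Finset.mem_sdiff.1 hb).2 (h (Finset.mem_sdiff.1 hb).1)
      have hcardB : (supp (restrictTo Aᶜ D)).card < k := by
        rw [hsuppB, ← hk]
        refine Finset.card_lt_card ⟨Finset.sdiff_subset, fun h => ?_⟩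
        obtain ⟨a, ha⟩ := hAne
        exact (Finset.mem_sdiff.1 (h (hAsub ha))).2 ha
      rcases hsplit with hA' | hB'
      · obtain ⟨A', hA'sub, hA'ne, hA'conn, hA'D, hA'S⟩ := ih _ hcardA (restrictTo A D) rfl hDA hA'
        rw [hsuppA] at hA'sub
        rw [restrictTo_restrictTo_of_subset D hA'sub] at hA'D hA'S
        exact ⟨A', hA'sub.trans hAsub, hA'ne, hA'conn, hA'D, hA'S⟩
      · obtain ⟨B', hB'sub, hB'ne, hB'conn, hB'D, hB'S⟩ := ih _ hcardB (restrictTo Aᶜ D) rfl hDB hB'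
        rw [hsuppB] at hB'sub
        have hB'c : B' ⊆ Aᶜ := fun i hi => Finset.mem_compl.2 (Finset.mem_sdiff.1 (hB'sub hi)).2
        rw [restrictTo_restrictTo_of_subset D hB'c] at hB'D hB'S
        exact ⟨B', hB'sub.trans Finset.sdiff_subset, hB'ne, hB'conn, hB'D, hB'S⟩

/-! ### Half-density of the piece under a minimum-weight decoder -/

/-- Arithmetic of `𝔽₂`: if `a + b ≠ 0` then `b ≠ 0 ↔ a = 0`. [folklore] -/
private theorem zmod2_ne_zero_iff_of_add_ne_zero : ∀ a b : ZMod 2, a + b ≠ 0 → (b ≠ 0 ↔ a = 0) := by decide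

/-- Arithmetic of `𝔽₂`: `b + (a + b) = a`. [folklore] -/
private theorem zmod2_add_add_cancel : ∀ a b : ZMod 2, b + (a + b) = a := by decide

/-- **Half of a flippable zero-syndrome piece is faulty.** Let `e'` be a minimum-weight solution of `H e' = H e`,
`D = e + e'`, and `A ⊆ supp D` such that `D|_A` has zero syndrome. Then `|A| ≤ 2 |A ∩ supp e|`: `x = e' + D|_A` has
the same syndrome, so `‖e'‖ ≤ ‖x‖`; off `A` the vectors `x` and `e'` agree, on `A` we have `x = e`, hence
`|A ∩ supp e'| ≤ |A ∩ supp e|`; and on `A ⊆ supp (e + e')` exactly one of `e i`, `e' i` is non-zero, so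
`A ∩ supp e' = A ∖ supp e`. (Gottesman 2014, proof of Thm. 3: "`wt E|_S ≤ wt F|_S` or else we could modify `E` by
making it equal to `F` within `S` and in the process shorten `E`"; Dennis et al. 2002 §5.2 eq. (e_m_ineq2).)
[cite: Gottesman2014, Thm 3 (proof)] -/
theorem card_le_two_mul_card_inter_of_minWeight (H : Matrix (Fin m) (Fin n) (ZMod 2)) {e e' : Fin n → ZMod 2}
    (hsyn : H *ᵥ e' = H *ᵥ e)
    (hmin : ∀ x : Fin n → ZMod 2, H *ᵥ x = H *ᵥ e → hammingNorm e' ≤ hammingNorm x)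
    {A : Finset (Fin n)} (hA : A ⊆ supp (e + e')) (hDA : H *ᵥ restrictTo A (e + e') = 0) :
    A.card ≤ 2 * (A ∩ supp e).card := by
  classical
  set x : Fin n → ZMod 2 := e' + restrictTo A (e + e') with hx
  have hsynx : H *ᵥ x = H *ᵥ e := by
    rw [hx, Matrix.mulVec_add, hDA, add_zero, hsyn]
  have hle : hammingNorm e' ≤ hammingNorm x := hmin x hsynx
  rw [← card_supp, ← card_supp] at hle
  -- off `A`: `x = e'`
  have hoff : supp x \ A = supp e' \ A := by
    ext i
    simp only [Finset.mem_sdiff, mem_supp]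
    constructor
    · rintro ⟨h1, h2⟩
      rw [hx, Pi.add_apply, restrictTo_apply_of_not_mem h2, add_zero] at h1
      exact ⟨h1, h2⟩
    · rintro ⟨h1, h2⟩
      refine ⟨?_, h2⟩
      rw [hx, Pi.add_apply, restrictTo_apply_of_not_mem h2, add_zero]
      exact h1
  -- on `A`: `x = e`
  have hon : supp x ∩ A = supp e ∩ A := by
    ext i
    simp only [Finset.mem_inter, mem_supp]
    constructor
    · rintro ⟨h1, h2⟩
      rw [hx, Pi.add_apply, restrictTo_apply_of_mem h2, Pi.add_apply, zmod2_add_add_cancel] at h1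
      exact ⟨h1, h2⟩
    · rintro ⟨h1, h2⟩
      refine ⟨?_, h2⟩
      rw [hx, Pi.add_apply, restrictTo_apply_of_mem h2, Pi.add_apply, zmod2_add_add_cancel]
      exact h1
  -- on `A`: exactly one of `e`, `e'` is non-zero
  have hone : supp e' ∩ A = A \ supp e := by
    ext i
    simp only [Finset.mem_inter, Finset.mem_sdiff, mem_supp, not_not]
    constructor
    · rintro ⟨h1, h2⟩
      have h3 : (e + e') i ≠ 0 := mem_supp.1 (hA h2)
      exact ⟨h2, (zmod2_ne_zero_iff_of_add_ne_zero (e i) (e' i) h3).1 h1⟩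
    · rintro ⟨h2, h1⟩
      have h3 : (e + e') i ≠ 0 := mem_supp.1 (hA h2)
      exact ⟨(zmod2_ne_zero_iff_of_add_ne_zero (e i) (e' i) h3).2 h1, h2⟩
  have hsplit_e' : (supp e' \ A).card + (supp e' ∩ A).card = (supp e').card :=
    Finset.card_sdiff_add_card_inter _ _
  have hsplit_x : (supp x \ A).card + (supp x ∩ A).card = (supp x).card :=
    Finset.card_sdiff_add_card_inter _ _
  have hsplit_A : (A \ supp e).card + (A ∩ supp e).card = A.card := Finset.card_sdiff_add_card_inter _ _
  rw [hoff, hon] at hsplit_x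
  rw [hone] at hsplit_e'
  have hcomm : (supp e ∩ A).card = (A ∩ supp e).card := by rw [Finset.inter_comm]
  omega

/-! ### The coding half of the counting-bound threshold theorem -/

/-- **Failure of minimum-weight decoding forces a dense connected cluster** (Kovalev–Pryadko 2013 Thm. 3 /
Gottesman 2014 Thm. 3, coding half, for one error type of a CSS code). Let `H` be the check matrix and `SX` the
subspace of trivial errors, and suppose every zero-syndrome vector outside `SX` has weight `≥ d` (i.e. `d ≤ d_X`).
If `e'` is a minimum-weight vector with the syndrome of `e` (`H e' = H e` and `‖e'‖ ≤ ‖x‖` whenever `H x = H e`) and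
decoding fails (`e + e' ∉ SX`), then there is a `checkGraph H`-connected vertex set `S` with `d ≤ |S|` and
`|S| ≤ 2 |S ∩ supp e|` — the event `HasDenseCluster (checkGraph H) d (supp e)` of `ClusterCountingBound.lean`.
Printed form: "if this decoding procedure results in a logical error, then there must be some connected cluster of
`s ≥ d_i` qubits such that the cluster contains `m ≥ ⌈s/2⌉` errors in the actual fault path".
[cite: Gottesman2014, Thm 3 (proof, first claim)] -/
theorem exists_denseCluster_of_minWeight_failure (H : Matrix (Fin m) (Fin n) (ZMod 2))
    (SX : Submodule (ZMod 2) (Fin n → ZMod 2)) {d : ℕ}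
    (hd : ∀ x : Fin n → ZMod 2, H *ᵥ x = 0 → x ∉ SX → d ≤ hammingNorm x)
    {e e' : Fin n → ZMod 2} (hsyn : H *ᵥ e' = H *ᵥ e)
    (hmin : ∀ x : Fin n → ZMod 2, H *ᵥ x = H *ᵥ e → hammingNorm e' ≤ hammingNorm x)
    (hfail : e + e' ∉ SX) :
    ∃ S : Finset (Fin n), IsGraphConnected (checkGraph H) S ∧ d ≤ S.card ∧ S.card ≤ 2 * (S ∩ supp e).card := by
  classical
  -- `D = e + e'` has zero syndrome (characteristic two)
  have hD : H *ᵥ (e + e') = 0 := by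
    rw [Matrix.mulVec_add, hsyn]
    funext i
    exact CharTwo.add_self_eq_zero _
  obtain ⟨A, hAsub, -, hAconn, hAD, hAS⟩ := exists_connected_piece H SX hD hfail
  refine ⟨A, hAconn, ?_, card_le_two_mul_card_inter_of_minWeight H hsyn hmin hAsub hAD⟩
  have h := hd _ hAD hAS
  rwa [← card_supp, supp_restrictTo_of_subset hAsub] at h

/-- **Classical special case** (`SX = ⊥`: a binary linear code with parity-check matrix `H` of minimum distance
`≥ d`, minimum-weight = nearest-codeword decoding): a decoding error `e' ≠ e` forces a `checkGraph H`-connected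
`S` with `d ≤ |S| ≤ 2|S ∩ supp e|`. (Kovalev–Pryadko 2013 Thm. 3, "quantum or classical".)
[cite: KovalevPryadko2013, Thm 3 (classical case)] -/
theorem exists_denseCluster_of_minWeight_failure_classical (H : Matrix (Fin m) (Fin n) (ZMod 2)) {d : ℕ}
    (hd : ∀ x : Fin n → ZMod 2, H *ᵥ x = 0 → x ≠ 0 → d ≤ hammingNorm x)
    {e e' : Fin n → ZMod 2} (hsyn : H *ᵥ e' = H *ᵥ e)
    (hmin : ∀ x : Fin n → ZMod 2, H *ᵥ x = H *ᵥ e → hammingNorm e' ≤ hammingNorm x) (hfail : e' ≠ e) :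
    ∃ S : Finset (Fin n), IsGraphConnected (checkGraph H) S ∧ d ≤ S.card ∧ S.card ≤ 2 * (S ∩ supp e).card := by
  refine exists_denseCluster_of_minWeight_failure H ⊥ (fun x hx hx0 => hd x hx ?_) hsyn hmin ?_
  · simpa using hx0
  · intro h
    rw [Submodule.mem_bot] at h
    apply hfail
    funext i
    have hi := congrFun h i
    rw [Pi.add_apply, Pi.zero_apply] at hi
    -- `e i + e' i = 0` in `𝔽₂` forces `e' i = e i`
    have key : ∀ a b : ZMod 2, a + b = 0 → b = a := by decide
    exact key _ _ hi

end Decoding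

end Literature.InformationTheory.QuantumCodes
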